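import Literature.AlgebraicGeometry.Hyperkaehler.OGradySixType
import Literature.AlgebraicGeometry.HodgeTheory.MotivatedClasses
import Literature.AlgebraicGeometry.Motives.AbelianVariety
import HarnessLib.Audit
import HarnessLib

/-!
# OpenQuestionsVoisin2022 — the degree-3 "transfer lens" of a projective hyper-Kähler variety, as OPEN STATEMENTS (conjecture leaf; obligations of HodgeConjecture/HodgeConjecture)

Cross-ladder literature-typing tranche LT-H4 (OPEN-QUESTION HARVEST), seat `hodge-lit-oqh-1`, cell
`pub/vhodge/lit-oqh` (director-hodge g4, 2026-08-26; D-0088(4)).  Source of this file: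

* C. Voisin, *Footnotes to papers of O'Grady and Markman*, Math. Z. 300 (2022) 3405–3416 = arXiv:2106.06979
  [`Voisin2022FootnotesOGradyMarkman`; **REFEREED**; held text `paper:arxiv-2106.06979`, locators
  `pNNNN:Lnn` = chunk:line of that materialisation].

HONEST FRAMING.  Unproven statements are obligations of our theories, not Literature facts (human ruling
2026-08-15): this file is a conjecture LEAF — nothing but `@[conjecture]` definitions, importing only
`Literature.*` / `HarnessLib`; nothing is asserted, no `_holds` is in sight, nothing here bears on HC / HC_AV /
any Weil-class rung except as an INPUT SHAPE for the ideation ("lens") seats.  Typed ≠ proved ≠ endorsed.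

## What Voisin 2022 leaves open, with locators (and what is NOT open any more)

The paper proves, for EVERY hyper-Kähler manifold `X` of dimension `2n` with `b₃(X) ≠ 0` (not only
`Kumⁿ`-type): the O'Grady map `⋀²H³(X,ℚ) → H^{4n-2}(X,ℚ)` is surjective (Thm. 2.1, p0005:L17), `J³(X)`
contains a simple component of the Kuga–Satake variety of `H²(X,ℚ)_tr` (Thm. 1.3 (2), p0003:L46), and
`b₃(X) ≥ 2ᵏ` (Thm. 3.3; typed with Cor. 2.4, Lemma 2.5, Thm. 3.4, Cor. 3.5 in
`Literature/AlgebraicGeometry/Hyperkaehler/IrreducibleSymplecticOddCohomology.lean`); and, for PROJECTIVE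
`Kumⁿ`-TYPE `X`, that the Kuga–Satake correspondence is algebraic (Thm. 4.1, via Markman's Thm. 4.2 = JEMS
2023 Thm. 1.4; tree records `Hyperkaehler.OGradyVoisin2022_thirdJacobian_kugaSatake_kummerType`,
`Hyperkaehler.Markman2023_thirdCohomology_kummerType_discOneWeilFourfold`, file `KummerTypeIntermediateJacobian`).
What it NAMES as predicted-but-open is the degree-3 instance of Grothendieck's generalized Hodge conjecture
for hyper-Kähler manifolds — the mechanism ("transfer lens") by which Markman 2023 moved algebraicity between
a hyper-Kähler variety and the Weil-type abelian fourfold `J³(X)` (Voisin 2025 JOMP survey, p. 35 = p0020:L33: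
"Markman proved in [Mar23] the Hodge conjecture for Weil abelian 4-folds of discriminant 1, using a long
detour through hyper-Kähler manifolds of generalized Kummer type and some work of O'Grady"):

* p0004:L5–L10, verbatim: "He [Markman] also proves that the Abel-Jacobi map `Φ_X : CH²(X)_alg → J³(X)`,
  defined on the group of codimension 2 cycles on `X` algebraically equivalent to `0`, is surjective for a
  projective hyper-Kähler manifold `X` of generalized Kummer deformation type. This statement was expected
  as a consequence of the generalized Hodge conjecture because `H^{3,0}(X) = 0` (see [voisintorino])."
* p0010:L41–L48, verbatim: "for `X` as above, the Hodge structure on `H³(X,ℚ)` is of Hodge level `1`, that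
  is, of type `(2,1)+(1,2)`.  The generalized Hodge conjecture thus predicts that the degree `3` cohomology
  of `X` is supported on a (singular) divisor of `X`, and this is equivalent to the fact that the Griffiths
  Abel-Jacobi map `Φ_X : CH²(X)_alg → J³(X)` is surjective (see [voisintorino])."
* p0010:L52–L56, verbatim: "An equivalent version of Theorem 4.2 says that there exists a codimension [2]
  cycle `𝒵 ∈ CH²(J³(X) × X)_ℚ` such that the map `[𝒵]_* : H₁(J³(X),ℚ) → H³(X,ℚ)` is the natural
  identification `H₁(J³(X),ℚ) ≅ H³(X,ℚ)`."

`H^{3,0}(X) = 0` holds for every irreducible symplectic `X` (`h^{k,0} = 0` for odd `k`, Beauville 1983 §3 /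
Huybrechts 1999 §1), so the prediction is stated below for EVERY projective irreducible symplectic variety,
in the two printed forms — the coniveau form (GHC`(X, 3, 1)` literally: Grothendieck 1969; Voisin 2025
Conj. 4.6) and the cycle-on-`J³(X) × X` form (the shape of Markman's theorem and of the tree record above,
minus its Weil clause).  KNOWN: `Kumⁿ`-type, `n ≥ 2` (REFEREED: Markman, JEMS 25 (2023) Thm. 1.4, in the
tree in the second form).  The other known deformation types have `b₃ = 0` (K3^[n], OG6, OG10:
`OGradySixReference.finrank_complexBetti_odd`), where both statements hold trivially; they are OPEN exactly for the
(hypothetical, unclassified) hyper-Kähler deformation types with `b₃ ≠ 0` other than `Kumⁿ` — the hosts a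
"transfer lens for Weil SIXFOLDS/EIGHTFOLDS" would need (Voisin Thm. 1.3 (2)–(3): such an `X` has
`b₃ ≥ 2^{⌊(b₂-1)/2⌋}` and `J³(X)` contains a simple Kuga–Satake factor of `H²_tr`, of dimension a power of
`2` — §3 p0008:L1).  In print the correspondence form is a consequence of the Hodge conjecture for
`J³(X) × X` (level-`1` structures are `H¹` of an abelian variety; Voisin 2025 Prop. 4.8: "Conjecture 4.7 and
the Hodge conjecture together imply the generalized Hodge conjecture"); that on-path lemma
`HodgeConjecture → …` is NOT proved here (it needs the polarised intermediate Jacobian on the tree's carriers,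
cf. `HodgeTheory.DeligneMilne1982_Thm_6_20_essImage`) — director's rule for this tranche: statements only.

Which HodgeAV rung/route it feeds (one line, as asked): the `transfer` / `oqh` lens seats of rungs H2 (Weil
sixfolds, via split-eightfold hosts: `Ring2.WeilComponents.WeilClassesComponent 4 d δ`,
`WeilTypeLadder.SplitEightfolds`) and H3 (`Kumⁿ`, n ≥ 4, where it is already a theorem) — as the typed
INTERFACE "hyper-Kähler host `X` ↦ abelian variety `T = J³(X)` + algebraic correspondence `H¹(T) ≅ H³(X)`".

NOT typed here, with reasons: Thm. 1.3 (2) / Thm. 3.2 (Kuga–Satake factor of `J³(X)`) and §4's "the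
Kuga–Satake correspondence is algebraic" for `2n`-folds with `h^{2,0} = 1` (Voisin: "The Hodge conjecture
predicts that there is a cycle `Γ ∈ CH^{2n}(X × KS(X))_ℚ` … When this holds, we will say that the Kuga-Satake
correspondence is algebraic", p0010:L25–L29) — the tree's Kuga–Satake carriers
(`HodgeTheory.IsKugaSatakeVarietyBetti`, `IsKSCorrespondenceAlgebraicBetti`) are for SURFACES only; "the
subject [bounds on Betti numbers of hyper-Kähler manifolds] remains however wide open" (p0004:L1) and
"we do not know a priori the Hodge level of `H^{2k-1}(X,ℚ)`" (Prop. 2.3, p0005:L72) are not propositions.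
"LLSvS eightfolds" do not occur in this paper (0 hits for Lehn/LLSvS/eightfold/cubic in the held text).
-/

-- every declaration of this problem lives in `Summit.HodgeConjecture.HodgeConjecture.…` (summit = sub-problem)
set_option linter.dupNamespace false

noncomputable section

open CategoryTheory

namespace Summit.HodgeConjecture.HodgeConjecture.OpenQuestionsVoisin2022

open Literature.AlgebraicGeometry Literature.AlgebraicGeometry.Motives
open Literature.AlgebraicGeometry.HodgeTheory
open Literature.AlgebraicGeometry.Hyperkaehler

/-- **V1 — degree-3 cohomology of a projective hyper-Kähler variety is supported on a divisor
(GHC`(X, 3, 1)`, coniveau form).**  Voisin 2022 §4 (p0010:L41–L48): "the Hodge structure on `H³(X,ℚ)` is of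
Hodge level `1` […] The generalized Hodge conjecture thus predicts that the degree `3` cohomology of `X`
is supported on a (singular) divisor of `X`"; §1 (p0004:L10): "expected as a consequence of the generalized
Hodge conjecture because `H^{3,0}(X) = 0`".  Rendering: for `2 ≤ n` and `X` a projective irreducible
symplectic variety of dimension `2n` (`Hyperkaehler.IsProjectiveIrreducibleSymplectic`), every class of
`H³(X(ℂ); ℂ)` is supported in codimension `≥ 1`: `HodgeTheory.supportedClasses X 3 1 = ⊤` (Grothendieck's
`N¹H³` with `ℂ`-coefficients, file `HodgeTheory/AlgebraicClasses`; `N¹H³(X,ℚ) ⊗ ℂ = N¹H³(X(ℂ);ℂ)`).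
KNOWN for `Kumⁿ`-type (Markman, JEMS 25 (2023) Thm. 1.4: `Φ_X` surjective, "equivalent", loc. cit.;
REFEREED); trivially true when `b₃ = 0` (K3^[n], OG6, OG10); OPEN for any further hyper-Kähler deformation
type with `b₃ ≠ 0` (none is known — Voisin Thm. 3.3 forces `b₃ ≥ 2^{⌊(b₂-1)/2⌋}` there).  A case of
Grothendieck's generalized Hodge conjecture (Voisin 2025, Conj. 4.6), NOT of `HodgeConjecture` alone in the
kernel (in print: HC for `J³(X) × X` suffices, Voisin 2025 Prop. 4.8 with the level-`1` case of Conj. 4.7).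
Source REFEREED; statement = conjecture.
[cite: Voisin2022FootnotesOGradyMarkman, §4 before Thm. 4.2 (arXiv:2106.06979 p. 9) and §1 (p. 2)]
[cite: GrothendieckTopology1969, §1] [cite: Voisin2025GHCConiveauSurvey, Conj. 4.6 and Prop. 4.8] [status: open] -/
@[conjecture] def DegreeThreeSupportedOnDivisor : Prop :=
  ∀ (n : ℕ), 2 ≤ n → ∀ ⦃X : Motives.SchemeOver ℂ⦄, IsProjectiveIrreducibleSymplectic (2 * n) X →
    supportedClasses X 3 1 = ⊤

/-- **V2 — the third cohomology of a projective hyper-Kähler variety is carried by an abelian variety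
through an algebraic correspondence (the cycle-on-`J³(X) × X` form; the "transfer lens").**  Voisin 2022 §4
(p0010:L52–L56): "An equivalent version of Theorem 4.2 [Markman: `Φ_X : CH²(X)_alg → J³(X)` is surjective
for projective `X` of Kummer type] says that there exists a codimension [2] cycle `𝒵 ∈ CH²(J³(X) × X)_ℚ`
such that the map `[𝒵]_* : H₁(J³(X),ℚ) → H³(X,ℚ)` is the natural identification `H₁(J³(X),ℚ) ≅ H³(X,ℚ)`";
with p0010:L41–L48 this is what "the generalized Hodge conjecture thus predicts" for every `X` with
`H^{3,0}(X) = 0`.  Rendering — literally the correspondence clause of the tree record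
`Hyperkaehler.Markman2023_thirdCohomology_kummerType_discOneWeilFourfold` (its KNOWN `Kumⁿ` case,
REFEREED: O'Grady IMRN 2021 Thm. 1.5, Markman JEMS 2023 Thm. 1.4) with the `Kumⁿ`/Weil/fourfold clauses
dropped: for `2 ≤ n` and `X` projective irreducible symplectic of dimension `2n` there are a complex abelian
variety `T` (print: `J³(X)`, `dim T = b₃/2`) and a `ℂ`-linear BIJECTION `γ : H¹(T(ℂ); ℂ) → H³(X(ℂ); ℂ)`
induced by an algebraic correspondence on `X × T` (`HodgeTheory.IsAlgebraicCorrespondence (2 * n) T.dim X T.X γ`: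
`γ = Γ^*` for a class `Γ` in the `ℂ`-span of cycle classes; print's RATIONAL cycle gives this, so nothing
beyond print is asked).  When `b₃ = 0` take `T = 0`.  OPEN beyond `Kumⁿ`-type exactly as V1 (equivalent to
V1 in print, [voisintorino]; not in the kernel).  In print a consequence of the Hodge conjecture for
`J³(X) × X` (Voisin 2025 Prop. 4.8; the level-`1` structure `H³(X)` is `H¹(J³(X))(-1)`); the on-path lemma
is not proved here.  Feeds: lens seats of rungs H2/H3 (host `X` ↦ Weil-type factor of `T`, Voisin Thm. 1.3 (2)).
Source REFEREED; statement = conjecture.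
[cite: Voisin2022FootnotesOGradyMarkman, proof of Thm. 4.1 (§4, arXiv:2106.06979 p. 10) and §1 (p. 2)]
[cite: Markman2023GeneralizedKummers, Thm. 1.4 (§1.3)] [cite: Voisin2025GHCConiveauSurvey, Prop. 4.8] [status: open] -/
@[conjecture] def DegreeThreeFromAbelianVariety : Prop :=
  ∀ (n : ℕ), 2 ≤ n → ∀ ⦃X : Motives.SchemeOver ℂ⦄, IsProjectiveIrreducibleSymplectic (2 * n) X →
    ∃ (T : Motives.AbelianVariety ℂ) (γ : complexBetti T.X 1 →ₗ[ℂ] complexBetti X 3),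
      Function.Bijective γ ∧ IsAlgebraicCorrespondence (2 * n) T.dim X T.X γ

end Summit.HodgeConjecture.HodgeConjecture.OpenQuestionsVoisin2022

end
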